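import Mathlib

/-!
# The corner-band lemma in full generality (kernel #229, lemmaR-A5 §28)

Solo-blind programme, session s89.  This file merges kernels #226 (variable injection weight),
#227 (whole conservative chain) and #228 (forcing and the bare majorant) into the single statement used
by the corner band of the 2-D certificate:

SYSTEM (real, staggered-phase form of the leaf-aligned chain at tilt `κ > 0`):
  `u' = α u - B w y_{i₀} + f`,   `y_i' = -Λ_i y_i + w c_i + δ(t) w u [i = i₀]`,   `Σ_i y_i c_i = 0`,
with read-out weight `B ≥ 0`, injection weight `δ(t) > 0`, arbitrary fast factor `w(t)`, arbitrary
forcing `f(t)` with `|f| ≤ g`.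
LEAF HYPOTHESIS: `2(Λ_i + α) + δ'/δ ≥ 0` for every chain mode.
CONCLUSION: if `φ ≥ 0` solves the bare majorant equation `φ' = αφ + g` with `φ(t') ≥ |u(t')|` and the
chain starts empty (`y(t') = 0`), then `u(t)² ≤ φ(t)²` for all `t ≥ t'`.

So the passively dressed slow mode obeys the undressed variation-of-constants majorant: the corner band
inherits the κ = 0⁺ column certificate with the same slow propagator (lemmaR-A5 §28 (e)).
-/

namespace Summit.AnomalousDissipation.AnomalousDissipation.Theorems

open Set Filter Topology Finset

/-- Evaluation of the chain's energy production (damping, conservative coupling, injection). -/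
theorem corner_chain_sum_eval {n : ℕ} (Y Λv cv : Fin n → ℝ) (wt δt ut : ℝ) (i₀ : Fin n) :
    ∑ i, ((-Λv i * Y i + wt * cv i + δt * wt * ut * (if i = i₀ then 1 else 0)) * Y i
        + Y i * (-Λv i * Y i + wt * cv i + δt * wt * ut * (if i = i₀ then 1 else 0)))
      = -2 * ∑ i, Λv i * (Y i * Y i) + 2 * wt * ∑ i, Y i * cv i + 2 * δt * wt * ut * Y i₀ := by
  have e1 : ∀ i, ((-Λv i * Y i + wt * cv i + δt * wt * ut * (if i = i₀ then 1 else 0)) * Y i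
      + Y i * (-Λv i * Y i + wt * cv i + δt * wt * ut * (if i = i₀ then 1 else 0)))
      = -2 * (Λv i * (Y i * Y i)) + 2 * wt * (Y i * cv i)
        + 2 * δt * wt * ut * (if i = i₀ then Y i else 0) := fun i => by
    split_ifs <;> ring
  simp_rw [e1]
  rw [sum_add_distrib, sum_add_distrib, ← mul_sum, ← mul_sum, ← mul_sum, Finset.sum_ite_eq']
  simp

/-- Energy `u² + B δ(t)⁻¹ Σ_i y_i²`. -/
noncomputable def cornerEnergy {n : ℕ} (u δ : ℝ → ℝ) (y : ℝ → Fin n → ℝ) (B : ℝ) (t : ℝ) : ℝ :=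
  u t ^ 2 + B * (δ t)⁻¹ * ∑ i, y t i ^ 2

/-- Exact derivative of the energy along the forced chain system with variable injection weight. -/
theorem cornerEnergy_hasDerivAt {n : ℕ} (u α w f δ δ' : ℝ → ℝ) (y Λ c : ℝ → Fin n → ℝ)
    (i₀ : Fin n) (B : ℝ) (t : ℝ) (hδ0 : δ t ≠ 0)
    (hu : HasDerivAt u (α t * u t - B * w t * y t i₀ + f t) t)
    (hy : ∀ i, HasDerivAt (fun s => y s i)
      (-Λ t i * y t i + w t * c t i + δ t * w t * u t * (if i = i₀ then 1 else 0)) t)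
    (hc : ∑ i, y t i * c t i = 0) (hδ : HasDerivAt δ (δ' t) t) :
    HasDerivAt (cornerEnergy u δ y B)
      (2 * α t * u t ^ 2 + 2 * u t * f t
        - B / δ t * ∑ i, (2 * Λ t i + δ' t / δ t) * y t i ^ 2) t := by
  unfold cornerEnergy
  have hu2 : HasDerivAt (fun s => u s ^ 2) (2 * u t * (α t * u t - B * w t * y t i₀ + f t)) t := by
    have := hu.mul hu
    have hfun : (fun s => u s ^ 2) = (u * u) := by funext s; simp [sq]
    rw [hfun]; refine this.congr_deriv ?_; ring
  have hS0 := HasDerivAt.sum (u := Finset.univ) fun i _ => (hy i).mul (hy i)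
  have hS : HasDerivAt (fun s => ∑ i, y s i ^ 2)
      (∑ i, ((-Λ t i * y t i + w t * c t i + δ t * w t * u t * (if i = i₀ then 1 else 0)) * y t i
        + y t i * (-Λ t i * y t i + w t * c t i + δ t * w t * u t * (if i = i₀ then 1 else 0)))) t := by
    have hfun : (fun s => ∑ i, y s i ^ 2) = ∑ i, ((fun s => y s i) * fun s => y s i) := by
      funext s; simp [Finset.sum_apply, sq]
    rw [hfun]; exact hS0
  have hw : HasDerivAt (fun s => B * (δ s)⁻¹) (B * (-(δ' t) / δ t ^ 2)) t := (hδ.inv hδ0).const_mul B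
  have hall := hu2.add (hw.mul hS)
  refine hall.congr_deriv ?_
  rw [corner_chain_sum_eval, hc]
  have hsplit : ∑ i, (2 * Λ t i + δ' t / δ t) * y t i ^ 2
      = 2 * ∑ i, Λ t i * (y t i * y t i) + δ' t / δ t * ∑ i, y t i ^ 2 := by
    rw [mul_sum, mul_sum, ← sum_add_distrib]
    refine sum_congr rfl fun i _ => ?_
    ring
  have hsq : ∑ i, y t i ^ 2 = ∑ i, y t i * y t i := sum_congr rfl fun i _ => sq (y t i)
  rw [hsplit, hsq]
  field_simp
  ring

/-- THE CORNER-BAND LEMMA (lemmaR-A5 §28): dressed ≤ bare majorant, variable injection weight, whole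
conservative chain, arbitrary forcing and fast factor.  (`A` is any primitive of `α`; it is used only to
build the strict super-solution in the proof.) -/
theorem corner_band_lemma {n : ℕ} (u α w f g φ δ δ' A : ℝ → ℝ) (y Λ c : ℝ → Fin n → ℝ)
    (i₀ : Fin n) (B : ℝ) (hB : 0 ≤ B) (hδpos : ∀ t, 0 < δ t)
    (hu : ∀ t, HasDerivAt u (α t * u t - B * w t * y t i₀ + f t) t)
    (hy : ∀ t i, HasDerivAt (fun s => y s i)
      (-Λ t i * y t i + w t * c t i + δ t * w t * u t * (if i = i₀ then 1 else 0)) t)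
    (hc : ∀ t, ∑ i, y t i * c t i = 0) (hδ : ∀ t, HasDerivAt δ (δ' t) t)
    (hleaf : ∀ t i, 0 ≤ 2 * (Λ t i + α t) + δ' t / δ t)
    (hfg : ∀ t, |f t| ≤ g t)
    (hφ : ∀ t, HasDerivAt φ (α t * φ t + g t) t) (hφpos : ∀ t, 0 ≤ φ t)
    (hA : ∀ t, HasDerivAt A (α t) t)
    (t' : ℝ) (hy0 : y t' = 0) (hinit : |u t'| ≤ φ t') :
    ∀ t, t' ≤ t → u t ^ 2 ≤ φ t ^ 2 := by
  intro T hT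
  set E : ℝ → ℝ := cornerEnergy u δ y B with hEdef
  set E' : ℝ → ℝ := fun t => 2 * α t * u t ^ 2 + 2 * u t * f t
      - B / δ t * ∑ i, (2 * Λ t i + δ' t / δ t) * y t i ^ 2 with hE'def
  have hE : ∀ t, HasDerivAt E (E' t) t := fun t =>
    cornerEnergy_hasDerivAt u α w f δ δ' y Λ c i₀ B t (hδpos t).ne' (hu t) (hy t) (hc t) (hδ t)
  -- strict super-solution ψ_ε = φ + ε η, η = e^{A t - A t'} (1 + (t - t'))
  set η : ℝ → ℝ := fun t => Real.exp (A t - A t') * (1 + (t - t')) with hηdef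
  have hη : ∀ t, HasDerivAt η (α t * η t + Real.exp (A t - A t')) t := by
    intro t
    have h1 : HasDerivAt (fun s => A s - A t') (α t) t := by
      simpa using (hA t).sub_const (A t')
    have h2 : HasDerivAt (fun s => Real.exp (A s - A t')) (Real.exp (A t - A t') * α t) t := h1.exp
    have h3 : HasDerivAt (fun s => (1 + (s - t'))) (1 : ℝ) t := by
      simpa using ((hasDerivAt_id t).sub_const t').const_add 1
    have h4 := h2.mul h3
    refine h4.congr_deriv ?_
    simp only [hηdef]
    ring
  have hηpos : ∀ t, t' ≤ t → 0 < η t := fun t ht => by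
    simp only [hηdef]
    have : 0 < 1 + (t - t') := by linarith
    positivity
  have hcomp : ∀ ε : ℝ, 0 < ε → E T ≤ (φ T + ε * η T) ^ 2 := by
    intro ε hε
    set ψ : ℝ → ℝ := fun t => φ t + ε * η t with hψdef
    have hψ : ∀ t, HasDerivAt ψ (α t * ψ t + g t + ε * Real.exp (A t - A t')) t := by
      intro t
      have := (hφ t).add ((hη t).const_mul ε)
      refine this.congr_deriv ?_
      simp only [hψdef]
      ring
    have hψpos : ∀ t, t' ≤ t → 0 < ψ t := fun t ht => by
      simp only [hψdef]
      have := hηpos t ht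
      have := hφpos t
      positivity
    set Bd : ℝ → ℝ := fun t => ψ t ^ 2 with hBddef
    set Bd' : ℝ → ℝ := fun t => 2 * ψ t * (α t * ψ t + g t + ε * Real.exp (A t - A t')) with hBd'def
    have hBd : ∀ t, HasDerivAt Bd (Bd' t) t := by
      intro t
      have := (hψ t).mul (hψ t)
      have hfun : Bd = (ψ * ψ) := by funext s; simp [hBddef, sq]
      rw [hfun]
      refine this.congr_deriv ?_
      simp only [hBd'def]
      ring
    have key := image_le_of_deriv_right_lt_deriv_boundary' (f := E) (f' := E') (a := t') (b := T)
      (fun x _ => (hE x).continuousAt.continuousWithinAt)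
      (fun x _ => (hE x).hasDerivWithinAt)
      (B := Bd) (B' := Bd') ?_ (fun x _ => (hBd x).continuousAt.continuousWithinAt)
      (fun x _ => (hBd x).hasDerivWithinAt) ?_
    · exact key (right_mem_Icc.mpr hT)
    · -- initial comparison
      simp only [hEdef, cornerEnergy, hy0, hBddef, hψdef]
      have h1 : u t' ^ 2 ≤ φ t' ^ 2 := by
        have := sq_le_sq' (by linarith [abs_le.mp hinit]) (abs_le.mp hinit).2
        simpa using this
      have h2 : φ t' ≤ φ t' + ε * η t' := by
        have := hηpos t' le_rfl; nlinarith
      have h3 : φ t' ^ 2 ≤ (φ t' + ε * η t') ^ 2 := by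
        have := hφpos t'
        exact pow_le_pow_left₀ this h2 2
      simp
      linarith
    · -- strict crossing at touching points
      intro x hx hEx
      have hx' : t' ≤ x := hx.1
      have hψx := hψpos x hx'
      have hEx' : u x ^ 2 + B * (δ x)⁻¹ * ∑ i, y x i ^ 2 = ψ x ^ 2 := by
        simpa [hEdef, cornerEnergy, hBddef] using hEx
      have hS0 : 0 ≤ ∑ i, y x i ^ 2 := sum_nonneg fun i _ => sq_nonneg _
      have hδx := hδpos x
      have hyx : 0 ≤ B * (δ x)⁻¹ * ∑ i, y x i ^ 2 := by
        have : 0 ≤ (δ x)⁻¹ := inv_nonneg.mpr hδx.le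
        positivity
      have hux : |u x| ≤ ψ x := by
        have : u x ^ 2 ≤ ψ x ^ 2 := by linarith
        exact abs_le.mpr (abs_le_of_sq_le_sq' this hψx.le)
      have h1 : 2 * u x * f x ≤ 2 * ψ x * g x := by
        have hu1 : |u x * f x| ≤ ψ x * g x := by
          rw [abs_mul]
          exact mul_le_mul hux (hfg x) (abs_nonneg _) hψx.le
        have := le_abs_self (u x * f x)
        linarith
      -- the leaf hypothesis gives the dissipation sign
      have hS2 : 0 ≤ ∑ i, (2 * (Λ x i + α x) + δ' x / δ x) * y x i ^ 2 :=
        sum_nonneg fun i _ => mul_nonneg (hleaf x i) (sq_nonneg _)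
      have hsumid : ∑ i, (2 * (Λ x i + α x) + δ' x / δ x) * y x i ^ 2
          = ∑ i, (2 * Λ x i + δ' x / δ x) * y x i ^ 2 + 2 * α x * ∑ i, y x i ^ 2 := by
        rw [mul_sum, ← sum_add_distrib]
        refine sum_congr rfl fun i _ => ?_
        ring
      have h2 : 2 * α x * u x ^ 2 - B / δ x * ∑ i, (2 * Λ x i + δ' x / δ x) * y x i ^ 2
          ≤ 2 * α x * ψ x ^ 2 := by
        have e2 : 2 * α x * ψ x ^ 2
            - (2 * α x * u x ^ 2 - B / δ x * ∑ i, (2 * Λ x i + δ' x / δ x) * y x i ^ 2)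
            = B / δ x * ∑ i, (2 * (Λ x i + α x) + δ' x / δ x) * y x i ^ 2 := by
          rw [← hEx', hsumid, div_eq_mul_inv]; ring
        have : 0 ≤ B / δ x * ∑ i, (2 * (Λ x i + α x) + δ' x / δ x) * y x i ^ 2 := by
          have : 0 ≤ B / δ x := div_nonneg hB hδx.le
          positivity
        linarith [e2, this]
      have h3 : 0 < 2 * ψ x * (ε * Real.exp (A x - A t')) := by positivity
      show E' x < Bd' x
      simp only [hE'def, hBd'def]
      nlinarith [h1, h2, h3]
  -- ε → 0
  have hlim : Tendsto (fun ε : ℝ => (φ T + ε * η T) ^ 2) (𝓝[>] 0) (𝓝 ((φ T + 0 * η T) ^ 2)) := by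
    have hcn : Continuous (fun ε : ℝ => (φ T + ε * η T) ^ 2) := by continuity
    exact (hcn.tendsto 0).mono_left nhdsWithin_le_nhds
  simp only [zero_mul, add_zero] at hlim
  have hET : E T ≤ φ T ^ 2 :=
    ge_of_tendsto hlim (eventually_nhdsWithin_of_forall fun ε hε => hcomp ε hε)
  have : u T ^ 2 ≤ E T := by
    simp only [hEdef, cornerEnergy]
    have hS0 : 0 ≤ ∑ i, y T i ^ 2 := sum_nonneg fun i _ => sq_nonneg _
    have : 0 ≤ (δ T)⁻¹ := inv_nonneg.mpr (hδpos T).le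
    have : 0 ≤ B * (δ T)⁻¹ * ∑ i, y T i ^ 2 := by positivity
    linarith
  linarith

end Summit.AnomalousDissipation.AnomalousDissipation.Theorems
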